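import Literature.NumberTheory.Sieve.DrappeauDispersionOrthogonality
import HarnessLib

/-!
# Drappeau 2017, §5.3: the dispersion skeleton `|𝒟|² ≤ (∑ α τ^{2A}) (𝒮₁ − 2 Re 𝒮₂ + 𝒮₃)`

Definitions and proof.

S. Drappeau, *Sums of Kloosterman sums in arithmetic progressions, and the error term in the
dispersion method*, Proc. London Math. Soc. (3) 114 (2017) 684–732 = arXiv:1504.05549
(`Drappeau2017`; held as `paper:arxiv-1504.05549`, §5.3 read on chunk 18).

The top of the printed proof of **Theorem 5.1** (`Literature.NumberTheory.Sieve.Drappeau2017_theorem51`):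
"Let `𝒟` denote the left-hand side of (5.9).  By the triangle inequality
`|𝒟| ≤ ∑_m |α_m| |∑_q ∑_n|` (5.10) … `|α_m| ≤ τ(m)^A α(m)` … the Cauchy–Schwarz inequality yields
`|𝒟| ≪ (∑_m α(m)τ(m)^A)^{1/2} (∑_m α(m) |∑_q ∑_n|²)^{1/2}
 ≪ (log x)^{O(1)} M^{1/2} (𝒮₁ − 2Re 𝒮₂ + 𝒮₃)^{1/2}`, where
`𝒮₁ = ∑_{(q₁q₂,a₁a₂)=1} γ(q₁)γ(q₂) ∑_{(n₁n₂,a₂)=1} β_{n₁}β̄_{n₂} ∑_{mnⱼ ≡ a₁ā₂ (qⱼ), j=1,2} α(m)`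
and `𝒮₂`, `𝒮₃` are defined similarly, replacing the sum over `m` by
`φ(q₂)⁻¹ ∑_{χ₂ ∈ 𝒳_{q₂}(R)} χ₂(n₂ā₁a₂) ∑_{mn₁ ≡ a₁ā₂ (q₁)} α(m)χ₂(m)`, resp.
`(φ(q₁)φ(q₂))⁻¹ ∑_{χ₁,χ₂} χ₁(n₁ā₁a₂) χ̄₂(n₂ā₁a₂) ∑_{(mnⱼ,qⱼ)=1} α(m) χ₁χ̄₂(m)`" ((5.10)–(5.13)).

## Contents (real definitions + proved statements; no named facts)

* `kerArg a₁ a₂ q m n = m n ā₁ a₂ ∈ ℤ/qℤ` — the argument of the kernel in (5.5)/(5.9), literally the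
  one of `Drappeau2017_theorem51`.
* `innerSum R a₁ a₂ 𝒬 𝒩 γ β m = ∑_{q ∈ 𝒬, (q,a₁a₂)=1} γ(q) ∑_{n ∈ 𝒩, (n,a₂)=1} β_n 𝔲_R(mn ā₁a₂; q)`
  (the "`∑_q ∑_n`" of (5.10)) and `dispSum … α β = ∑_{m ∈ ℳ} α_m · innerSum … m` (`= 𝒟`, the left
  side of (5.9) for a weight `γ` on a finite set of moduli; `dispSum_eq_sum_moduli` puts the `q`-sum
  outside as printed, and for `γ ≡ 1` on `q ∼ Q` this is the left side of (5.5)).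
* `dispS1`, `dispS2`, `dispS3` — `𝒮₁, 𝒮₂, 𝒮₃` for a weight `w(m)` (the smooth majorant `α(m)` of
  the source) on a finite `m`-range `ℳ`, written with the kernels: the `m`-sums are
  `∑_m w(m) 1₁ 1₂`, `∑_m w(m) 1₁ K̄₂`, `∑_m w(m) K₁ K̄₂`, where `1ⱼ = 1[m nⱼ ā₁a₂ ≡ 1 (qⱼ)]` and
  `Kⱼ = K_R(m nⱼ ā₁a₂; qⱼ)` (`Drappeau2017.mainKernel`, `= φ(qⱼ)⁻¹ ∑_{χ ∈ 𝒳_{qⱼ}(R)} χ(m nⱼ ā₁ a₂)`);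
  this is the printed form by multiplicativity of `χ`, the conjugations being immaterial since
  `K_R` is REAL (`conj_mainKernel`; likewise `conj_uR`).
* `sum_mul_norm_sq_innerSum_eq` — **the dispersion identity**
  `∑_m w(m) |∑_q ∑_n|² = 𝒮₁ − 𝒮₂ − 𝒮̄₂ + 𝒮₃` (`𝔲_R = 1 − K_R`, expand, and the two cross terms are
  complex conjugates of each other by the symmetry `1 ↔ 2`), and its real form
  `∑_m w(m) |∑_q ∑_n|² = Re 𝒮₁ − 2 Re 𝒮₂ + Re 𝒮₃` (`sum_mul_norm_sq_innerSum_eq_re`).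
* `norm_dispSum_sq_le` — **(5.10) + Cauchy–Schwarz**: if `|α_m| ≤ t(m) w(m)` on `ℳ` (`w, t ≥ 0`), then
  `|𝒟|² ≤ (∑_m w(m) t(m)²) · (Re 𝒮₁ − 2 Re 𝒮₂ + Re 𝒮₃)`.

Not here: the evaluations of `𝒮₃`, `𝒮₂` (§5.3.1–2: Poisson summation; their character sums are in
`…DrappeauDispersionOrthogonality`), of `𝒮₁` (§§5.4–5.5, Theorem 2.1 of the source), the main terms
(§5.6; kernel expansion in `…DrappeauDispersionKernelExpansion`), Theorem 5.1 itself.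

## References

* S. Drappeau, Proc. London Math. Soc. (3) 114 (2017) 684–732, arXiv:1504.05549, §5.3
  (5.9)–(5.13). [Drappeau2017]
-/

noncomputable section

open Finset DirichletCharacter

namespace Literature.NumberTheory.Sieve

namespace Drappeau2017

/-! ### The kernels are real -/

/-- `K_R(t; d)` is real: `𝒳_d(R)` is stable under `χ ↦ χ̄` (`cond χ̄ = cond χ`).
[cite: Drappeau2017, §5 (5.1)] -/
theorem conj_mainKernel (R : ℝ) (d : ℕ) (t : ZMod d) :
    starRingEnd ℂ (mainKernel R d t) = mainKernel R d t := by
  classical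
  unfold mainKernel
  rw [map_mul, map_inv₀, map_natCast, map_sum]
  congr 1
  refine Fintype.sum_equiv (Equiv.inv (DirichletCharacter ℂ d)) _ _ fun χ => ?_
  simp only [Equiv.inv_apply, conductor_inv]
  split_ifs
  · rw [conj_apply_eq_inv, MulChar.inv_apply_eq_inv']
  · exact map_zero _

/-- `𝔲_R(t; d)` is real. [cite: Drappeau2017, §5 (5.1)] -/
theorem conj_uR (R : ℝ) (d : ℕ) (t : ZMod d) : starRingEnd ℂ (uR R d t) = uR R d t := by
  classical
  unfold uR
  rw [map_mul, map_inv₀, map_natCast, map_sum]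
  congr 1
  refine Fintype.sum_equiv (Equiv.inv (DirichletCharacter ℂ d)) _ _ fun χ => ?_
  simp only [Equiv.inv_apply, conductor_inv]
  split_ifs
  · rw [conj_apply_eq_inv, MulChar.inv_apply_eq_inv']
  · exact map_zero _

/-! ### `𝒟` and the inner sum `∑_q ∑_n` -/

/-- The argument `m n ā₁ a₂ mod q` of the kernel in (5.5)/(5.9) (as in
`Literature.NumberTheory.Sieve.Drappeau2017_theorem51`). [cite: Drappeau2017, §5 (5.5)] -/
def kerArg (a₁ a₂ : ℤ) (q m n : ℕ) : ZMod q :=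
  ((m * n : ℕ) : ZMod q) * ((a₁ : ZMod q))⁻¹ * (a₂ : ZMod q)

/-- The inner sum of (5.10) at `m`:
`F(m) = ∑_{q ∈ 𝒬, (q, a₁a₂) = 1} γ(q) ∑_{n ∈ 𝒩, (n, a₂) = 1} β_n 𝔲_R(m n ā₁ a₂; q)`.
[cite: Drappeau2017, §5.3 (5.10)] -/
def innerSum (R : ℝ) (a₁ a₂ : ℤ) (𝒬 𝒩 : Finset ℕ) (γ : ℕ → ℝ) (β : ℕ → ℂ) (m : ℕ) : ℂ :=
  ∑ q ∈ 𝒬.filter (fun q : ℕ => IsCoprime (q : ℤ) (a₁ * a₂)), (γ q : ℂ) *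
    ∑ n ∈ 𝒩.filter (fun n : ℕ => IsCoprime (n : ℤ) a₂), β n * uR R q (kerArg a₁ a₂ q m n)

/-- The dispersion sum `𝒟 = ∑_{m ∈ ℳ} α_m F(m)`
`= ∑_{q ∈ 𝒬, (q,a₁a₂)=1} γ(q) ∑_{m ∈ ℳ} ∑_{n ∈ 𝒩, (n,a₂)=1} α_m β_n 𝔲_R(mn ā₁ a₂; q)` (the left side of
(5.9); `dispSum_eq_sum_moduli`). [cite: Drappeau2017, §5.3 (5.9)–(5.10)] -/
def dispSum (R : ℝ) (a₁ a₂ : ℤ) (𝒬 ℳ 𝒩 : Finset ℕ) (γ : ℕ → ℝ) (α β : ℕ → ℂ) : ℂ :=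
  ∑ m ∈ ℳ, α m * innerSum R a₁ a₂ 𝒬 𝒩 γ β m

/-- `𝒟` with the sum over the moduli outside, as printed in (5.9):
`𝒟 = ∑_{q, (q,a₁a₂)=1} γ(q) ∑_{m} ∑_{n, (n,a₂)=1} α_m β_n 𝔲_R(mn ā₁ a₂; q)`.
[cite: Drappeau2017, §5.3 (5.9)] -/
theorem dispSum_eq_sum_moduli (R : ℝ) (a₁ a₂ : ℤ) (𝒬 ℳ 𝒩 : Finset ℕ) (γ : ℕ → ℝ)
    (α β : ℕ → ℂ) :
    dispSum R a₁ a₂ 𝒬 ℳ 𝒩 γ α β =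
      ∑ q ∈ 𝒬.filter (fun q : ℕ => IsCoprime (q : ℤ) (a₁ * a₂)), (γ q : ℂ) *
        ∑ m ∈ ℳ, ∑ n ∈ 𝒩.filter (fun n : ℕ => IsCoprime (n : ℤ) a₂),
          α m * β n * uR R q (kerArg a₁ a₂ q m n) := by
  unfold dispSum innerSum
  simp only [Finset.mul_sum]
  rw [Finset.sum_comm]
  refine Finset.sum_congr rfl fun q _ => Finset.sum_congr rfl fun m _ =>
    Finset.sum_congr rfl fun n _ => ?_
  ring

/-! ### `𝒮₁, 𝒮₂, 𝒮₃` -/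

/-- `𝒮₁` of (5.12) for the weight `w` on the `m`-range `ℳ`:
`∑_{q₁,q₂, (qⱼ,a₁a₂)=1} γ(q₁)γ(q₂) ∑_{n₁,n₂, (nⱼ,a₂)=1} β_{n₁} β̄_{n₂} ∑_{m: m nⱼ ā₁a₂ ≡ 1 (qⱼ)} w(m)`.
[cite: Drappeau2017, §5.3 (5.12)] -/
def dispS1 (a₁ a₂ : ℤ) (𝒬 ℳ 𝒩 : Finset ℕ) (γ : ℕ → ℝ) (w : ℕ → ℝ) (β : ℕ → ℂ) : ℂ :=
  ∑ q₁ ∈ 𝒬.filter (fun q : ℕ => IsCoprime (q : ℤ) (a₁ * a₂)),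
    ∑ q₂ ∈ 𝒬.filter (fun q : ℕ => IsCoprime (q : ℤ) (a₁ * a₂)), (γ q₁ : ℂ) * (γ q₂ : ℂ) *
      ∑ n₁ ∈ 𝒩.filter (fun n : ℕ => IsCoprime (n : ℤ) a₂),
        ∑ n₂ ∈ 𝒩.filter (fun n : ℕ => IsCoprime (n : ℤ) a₂), β n₁ * starRingEnd ℂ (β n₂) *
          ∑ m ∈ ℳ, (w m : ℂ) * (if kerArg a₁ a₂ q₁ m n₁ = 1 then 1 else 0) *
            (if kerArg a₁ a₂ q₂ m n₂ = 1 then 1 else 0)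

/-- `𝒮₂` of (5.13) for the weight `w`: the `m`-sum is
`∑_m w(m) 1[m n₁ ā₁a₂ ≡ 1 (q₁)] K̄_R(m n₂ ā₁a₂; q₂)`, `K_R(t; q) = φ(q)⁻¹ ∑_{χ ∈ 𝒳_q(R)} χ(t)`
(printed: `φ(q₂)⁻¹ ∑_{χ₂ ∈ 𝒳_{q₂}(R)} χ₂(n₂ā₁a₂) ∑_m α(m)χ₂(m)`, the same by multiplicativity;
`K_R` is real, `conj_mainKernel`). [cite: Drappeau2017, §5.3 (5.13)] -/
def dispS2 (R : ℝ) (a₁ a₂ : ℤ) (𝒬 ℳ 𝒩 : Finset ℕ) (γ : ℕ → ℝ) (w : ℕ → ℝ) (β : ℕ → ℂ) : ℂ :=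
  ∑ q₁ ∈ 𝒬.filter (fun q : ℕ => IsCoprime (q : ℤ) (a₁ * a₂)),
    ∑ q₂ ∈ 𝒬.filter (fun q : ℕ => IsCoprime (q : ℤ) (a₁ * a₂)), (γ q₁ : ℂ) * (γ q₂ : ℂ) *
      ∑ n₁ ∈ 𝒩.filter (fun n : ℕ => IsCoprime (n : ℤ) a₂),
        ∑ n₂ ∈ 𝒩.filter (fun n : ℕ => IsCoprime (n : ℤ) a₂), β n₁ * starRingEnd ℂ (β n₂) *
          ∑ m ∈ ℳ, (w m : ℂ) * (if kerArg a₁ a₂ q₁ m n₁ = 1 then 1 else 0) *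
            starRingEnd ℂ (mainKernel R q₂ (kerArg a₁ a₂ q₂ m n₂))

/-- `𝒮₃` of (5.13)/(5.14) for the weight `w`: the `m`-sum is
`∑_m w(m) K_R(m n₁ ā₁a₂; q₁) K̄_R(m n₂ ā₁a₂; q₂)`
(printed: `(φ(q₁)φ(q₂))⁻¹ ∑_{χ₁,χ₂} χ₁(n₁ā₁a₂) χ̄₂(n₂ā₁a₂) ∑_m α(m) χ₁χ̄₂(m)`).
[cite: Drappeau2017, §5.3 (5.13)–(5.14)] -/
def dispS3 (R : ℝ) (a₁ a₂ : ℤ) (𝒬 ℳ 𝒩 : Finset ℕ) (γ : ℕ → ℝ) (w : ℕ → ℝ) (β : ℕ → ℂ) : ℂ :=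
  ∑ q₁ ∈ 𝒬.filter (fun q : ℕ => IsCoprime (q : ℤ) (a₁ * a₂)),
    ∑ q₂ ∈ 𝒬.filter (fun q : ℕ => IsCoprime (q : ℤ) (a₁ * a₂)), (γ q₁ : ℂ) * (γ q₂ : ℂ) *
      ∑ n₁ ∈ 𝒩.filter (fun n : ℕ => IsCoprime (n : ℤ) a₂),
        ∑ n₂ ∈ 𝒩.filter (fun n : ℕ => IsCoprime (n : ℤ) a₂), β n₁ * starRingEnd ℂ (β n₂) *
          ∑ m ∈ ℳ, (w m : ℂ) * mainKernel R q₁ (kerArg a₁ a₂ q₁ m n₁) *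
            starRingEnd ℂ (mainKernel R q₂ (kerArg a₁ a₂ q₂ m n₂))

/-! ### The dispersion identity -/

/-- A generic four-fold expansion: for real `γ, w`,
`∑_m w(m) |∑_{q} γ(q) ∑_{n} β_n e(q,n,m)|²
  = ∑_{q₁,q₂} γ(q₁)γ(q₂) ∑_{n₁,n₂} β_{n₁}β̄_{n₂} ∑_m w(m) e(q₁,n₁,m) ē(q₂,n₂,m)`. [folklore] -/
theorem sum_mul_norm_sq_sum_sum_eq (𝒬 ℳ 𝒩 : Finset ℕ) (γ w : ℕ → ℝ) (β : ℕ → ℂ)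
    (e : ℕ → ℕ → ℕ → ℂ) :
    (((∑ m ∈ ℳ, w m * ‖∑ q ∈ 𝒬, (γ q : ℂ) * ∑ n ∈ 𝒩, β n * e q n m‖ ^ 2 : ℝ)) : ℂ) =
      ∑ q₁ ∈ 𝒬, ∑ q₂ ∈ 𝒬, (γ q₁ : ℂ) * (γ q₂ : ℂ) *
        ∑ n₁ ∈ 𝒩, ∑ n₂ ∈ 𝒩, β n₁ * starRingEnd ℂ (β n₂) *
          ∑ m ∈ ℳ, (w m : ℂ) * (e q₁ n₁ m * starRingEnd ℂ (e q₂ n₂ m)) := by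
  -- `|z|² = z z̄` and expand the product of the two double sums, for each `m`
  have hsq : ∀ m ∈ ℳ, ((w m : ℝ) : ℂ) * (((‖∑ q ∈ 𝒬, (γ q : ℂ) * ∑ n ∈ 𝒩, β n * e q n m‖ : ℝ) : ℂ)) ^ 2 =
      ∑ q₁ ∈ 𝒬, ∑ q₂ ∈ 𝒬, (γ q₁ : ℂ) * (γ q₂ : ℂ) *
        ∑ n₁ ∈ 𝒩, ∑ n₂ ∈ 𝒩, β n₁ * starRingEnd ℂ (β n₂) *
          ((w m : ℂ) * (e q₁ n₁ m * starRingEnd ℂ (e q₂ n₂ m))) := by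
    intro m _
    have hA : starRingEnd ℂ (∑ q ∈ 𝒬, (γ q : ℂ) * ∑ n ∈ 𝒩, β n * e q n m) =
        ∑ q ∈ 𝒬, (γ q : ℂ) * ∑ n ∈ 𝒩, starRingEnd ℂ (β n) * starRingEnd ℂ (e q n m) := by
      rw [map_sum]
      refine Finset.sum_congr rfl fun q _ => ?_
      rw [map_mul, Complex.conj_ofReal, map_sum]
      refine congrArg _ (Finset.sum_congr rfl fun n _ => ?_)
      rw [map_mul]
    rw [← Complex.mul_conj', hA, Finset.sum_mul_sum, Finset.mul_sum]
    refine Finset.sum_congr rfl fun q₁ _ => ?_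
    rw [Finset.mul_sum]
    refine Finset.sum_congr rfl fun q₂ _ => ?_
    have hre : ((γ q₁ : ℂ) * ∑ n ∈ 𝒩, β n * e q₁ n m) *
        ((γ q₂ : ℂ) * ∑ n ∈ 𝒩, starRingEnd ℂ (β n) * starRingEnd ℂ (e q₂ n m)) =
        (γ q₁ : ℂ) * (γ q₂ : ℂ) * ((∑ n ∈ 𝒩, β n * e q₁ n m) *
          ∑ n ∈ 𝒩, starRingEnd ℂ (β n) * starRingEnd ℂ (e q₂ n m)) := by ring
    rw [hre, Finset.sum_mul_sum]
    simp only [Finset.mul_sum]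
    refine Finset.sum_congr rfl fun n₁ _ => Finset.sum_congr rfl fun n₂ _ => ?_
    ring
  push_cast
  rw [Finset.sum_congr rfl hsq, Finset.sum_comm]
  refine Finset.sum_congr rfl fun q₁ _ => ?_
  rw [Finset.sum_comm]
  refine Finset.sum_congr rfl fun q₂ _ => ?_
  rw [← Finset.mul_sum]
  congr 1
  rw [Finset.sum_comm]
  refine Finset.sum_congr rfl fun n₁ _ => ?_
  rw [Finset.sum_comm]
  refine Finset.sum_congr rfl fun n₂ _ => ?_
  rw [← Finset.mul_sum]

/-- **The dispersion identity** ((5.10)–(5.13)): for real `γ, w` and moduli `q ≥ 1`,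
`∑_{m ∈ ℳ} w(m) |F(m)|² = 𝒮₁ − 𝒮₂ − 𝒮̄₂ + 𝒮₃`
(`𝔲_R = 1[· = 1] − K_R`, expand; the two cross terms are conjugate under `1 ↔ 2`).
[cite: Drappeau2017, §5.3 (5.10)–(5.13)] -/
theorem sum_mul_norm_sq_innerSum_eq (R : ℝ) (a₁ a₂ : ℤ) (𝒬 ℳ 𝒩 : Finset ℕ) (γ w : ℕ → ℝ)
    (β : ℕ → ℂ) (h𝒬 : ∀ q ∈ 𝒬, 0 < q) :
    (((∑ m ∈ ℳ, w m * ‖innerSum R a₁ a₂ 𝒬 𝒩 γ β m‖ ^ 2 : ℝ)) : ℂ) =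
      dispS1 a₁ a₂ 𝒬 ℳ 𝒩 γ w β - dispS2 R a₁ a₂ 𝒬 ℳ 𝒩 γ w β -
        starRingEnd ℂ (dispS2 R a₁ a₂ 𝒬 ℳ 𝒩 γ w β) + dispS3 R a₁ a₂ 𝒬 ℳ 𝒩 γ w β := by
  classical
  set 𝒬' := 𝒬.filter (fun q : ℕ => IsCoprime (q : ℤ) (a₁ * a₂)) with h𝒬'
  set 𝒩' := 𝒩.filter (fun n : ℕ => IsCoprime (n : ℤ) a₂) with h𝒩'
  have h𝒬'pos : ∀ q ∈ 𝒬', 0 < q := fun q hq => h𝒬 q (Finset.mem_filter.1 hq).1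
  -- abbreviations: indicator `I`, kernel `K`, and the five-fold sum operator `Φ`
  set I : ℕ → ℕ → ℕ → ℂ := fun q n m => if kerArg a₁ a₂ q m n = 1 then 1 else 0 with hI
  set K : ℕ → ℕ → ℕ → ℂ := fun q n m => mainKernel R q (kerArg a₁ a₂ q m n) with hK
  set Φ : (ℕ → ℕ → ℕ → ℕ → ℕ → ℂ) → ℂ := fun F =>
    ∑ q₁ ∈ 𝒬', ∑ q₂ ∈ 𝒬', (γ q₁ : ℂ) * (γ q₂ : ℂ) *
      ∑ n₁ ∈ 𝒩', ∑ n₂ ∈ 𝒩', β n₁ * starRingEnd ℂ (β n₂) * ∑ m ∈ ℳ, F q₁ q₂ n₁ n₂ m with hΦ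
  have hΦsub : ∀ F G : ℕ → ℕ → ℕ → ℕ → ℕ → ℂ,
      Φ (fun q₁ q₂ n₁ n₂ m => F q₁ q₂ n₁ n₂ m - G q₁ q₂ n₁ n₂ m) = Φ F - Φ G := by
    intro F G
    simp only [hΦ, Finset.sum_sub_distrib, mul_sub]
  have hΦadd : ∀ F G : ℕ → ℕ → ℕ → ℕ → ℕ → ℂ,
      Φ (fun q₁ q₂ n₁ n₂ m => F q₁ q₂ n₁ n₂ m + G q₁ q₂ n₁ n₂ m) = Φ F + Φ G := by
    intro F G
    simp only [hΦ, Finset.sum_add_distrib, mul_add]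
  have hIreal : ∀ q n m, starRingEnd ℂ (I q n m) = I q n m := by
    intro q n m; simp only [hI]; split_ifs <;> simp
  -- `𝔲_R = 1 − K` on the moduli of `𝒬'`
  have huR : ∀ q ∈ 𝒬', ∀ n m, uR R q (kerArg a₁ a₂ q m n) = I q n m - K q n m := by
    intro q hq n m
    haveI : NeZero q := ⟨(h𝒬'pos q hq).ne'⟩
    have h := mainKernel_add_uR_eq_ite R (kerArg a₁ a₂ q m n)
    simp only [hI, hK]
    rw [← h]
    ring
  -- Step 1: the generic expansion with `e = 1 − K`
  have hinner : ∀ m, innerSum R a₁ a₂ 𝒬 𝒩 γ β m =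
      ∑ q ∈ 𝒬', (γ q : ℂ) * ∑ n ∈ 𝒩', β n * (I q n m - K q n m) := by
    intro m
    unfold innerSum
    exact Finset.sum_congr rfl fun q hq => by rw [Finset.sum_congr rfl fun n _ => by rw [huR q hq n m]]
  simp only [hinner]
  rw [sum_mul_norm_sq_sum_sum_eq 𝒬' ℳ 𝒩' γ w β (fun q n m => I q n m - K q n m)]
  change Φ (fun q₁ q₂ n₁ n₂ m => (w m : ℂ) * ((I q₁ n₁ m - K q₁ n₁ m) *
    starRingEnd ℂ (I q₂ n₂ m - K q₂ n₂ m))) = _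
  -- Step 2: split the summand into the four terms
  have hfun : (fun q₁ q₂ n₁ n₂ m => (w m : ℂ) * ((I q₁ n₁ m - K q₁ n₁ m) *
      starRingEnd ℂ (I q₂ n₂ m - K q₂ n₂ m))) =
      fun q₁ q₂ n₁ n₂ m =>
        ((w m : ℂ) * I q₁ n₁ m * I q₂ n₂ m - (w m : ℂ) * I q₁ n₁ m * starRingEnd ℂ (K q₂ n₂ m)) -
          (w m : ℂ) * K q₁ n₁ m * I q₂ n₂ m +
          (w m : ℂ) * K q₁ n₁ m * starRingEnd ℂ (K q₂ n₂ m) := by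
    funext q₁ q₂ n₁ n₂ m
    rw [map_sub, hIreal]
    ring
  rw [hfun, hΦadd, hΦsub, hΦsub]
  -- Step 3: identify the four pieces (`𝒮₁, 𝒮₂, 𝒮₃` by definition; the third is `𝒮̄₂` by `1 ↔ 2`)
  have hS2' : starRingEnd ℂ (dispS2 R a₁ a₂ 𝒬 ℳ 𝒩 γ w β) =
      Φ (fun q₁ q₂ n₁ n₂ m => (w m : ℂ) * K q₁ n₁ m * I q₂ n₂ m) := by
    simp only [hΦ, dispS2]
    rw [map_sum, Finset.sum_comm]
    refine Finset.sum_congr rfl fun q₁ _ => ?_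
    rw [map_sum]
    refine Finset.sum_congr rfl fun q₂ _ => ?_
    rw [map_mul, map_mul, Complex.conj_ofReal, Complex.conj_ofReal, map_sum, Finset.sum_comm,
      mul_comm (γ q₂ : ℂ) (γ q₁ : ℂ)]
    congr 1
    refine Finset.sum_congr rfl fun n₁ _ => ?_
    rw [map_sum]
    refine Finset.sum_congr rfl fun n₂ _ => ?_
    rw [map_mul, map_mul, map_sum, Complex.conj_conj]
    congr 1
    · ring
    · refine Finset.sum_congr rfl fun m _ => ?_
      rw [map_mul, map_mul, Complex.conj_ofReal, hIreal, Complex.conj_conj]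
      ring
  rw [hS2']
  rfl

/-- The real form of the dispersion identity:
`∑_m w(m) |F(m)|² = Re 𝒮₁ − 2 Re 𝒮₂ + Re 𝒮₃`. [cite: Drappeau2017, §5.3 (5.10)–(5.11)] -/
theorem sum_mul_norm_sq_innerSum_eq_re (R : ℝ) (a₁ a₂ : ℤ) (𝒬 ℳ 𝒩 : Finset ℕ) (γ w : ℕ → ℝ)
    (β : ℕ → ℂ) (h𝒬 : ∀ q ∈ 𝒬, 0 < q) :
    ∑ m ∈ ℳ, w m * ‖innerSum R a₁ a₂ 𝒬 𝒩 γ β m‖ ^ 2 =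
      (dispS1 a₁ a₂ 𝒬 ℳ 𝒩 γ w β).re - 2 * (dispS2 R a₁ a₂ 𝒬 ℳ 𝒩 γ w β).re +
        (dispS3 R a₁ a₂ 𝒬 ℳ 𝒩 γ w β).re := by
  have h := congrArg Complex.re (sum_mul_norm_sq_innerSum_eq R a₁ a₂ 𝒬 ℳ 𝒩 γ w β h𝒬)
  rw [Complex.ofReal_re] at h
  rw [h, Complex.add_re, Complex.sub_re, Complex.sub_re, Complex.conj_re]
  ring

/-! ### (5.10) and Cauchy–Schwarz -/

/-- **(5.10) with Cauchy–Schwarz**: if `|α_m| ≤ t(m) w(m)` on `ℳ` with `w, t ≥ 0` (in the source,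
`t = τ^A` and `w = α(·)`, a smooth majorant of `1_{(M,2M]}`), then
`|𝒟|² ≤ (∑_m w(m) t(m)²) · ∑_m w(m) |F(m)|²`. [cite: Drappeau2017, §5.3 (5.10)] -/
theorem norm_dispSum_sq_le_mul_sum (R : ℝ) (a₁ a₂ : ℤ) (𝒬 ℳ 𝒩 : Finset ℕ) (γ w t : ℕ → ℝ)
    (α β : ℕ → ℂ) (hw : ∀ m ∈ ℳ, 0 ≤ w m) (ht : ∀ m ∈ ℳ, 0 ≤ t m)
    (hα : ∀ m ∈ ℳ, ‖α m‖ ≤ t m * w m) :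
    ‖dispSum R a₁ a₂ 𝒬 ℳ 𝒩 γ α β‖ ^ 2 ≤
      (∑ m ∈ ℳ, w m * t m ^ 2) * ∑ m ∈ ℳ, w m * ‖innerSum R a₁ a₂ 𝒬 𝒩 γ β m‖ ^ 2 := by
  have htri : ‖dispSum R a₁ a₂ 𝒬 ℳ 𝒩 γ α β‖ ≤
      ∑ m ∈ ℳ, (Real.sqrt (w m) * t m) * (Real.sqrt (w m) * ‖innerSum R a₁ a₂ 𝒬 𝒩 γ β m‖) := by
    refine (norm_sum_le _ _).trans (Finset.sum_le_sum fun m hm => ?_)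
    rw [norm_mul]
    calc ‖α m‖ * ‖innerSum R a₁ a₂ 𝒬 𝒩 γ β m‖
        ≤ (t m * w m) * ‖innerSum R a₁ a₂ 𝒬 𝒩 γ β m‖ :=
          mul_le_mul_of_nonneg_right (hα m hm) (norm_nonneg _)
      _ = (Real.sqrt (w m) * t m) * (Real.sqrt (w m) * ‖innerSum R a₁ a₂ 𝒬 𝒩 γ β m‖) := by
          have := Real.mul_self_sqrt (hw m hm)
          linear_combination (-(t m * ‖innerSum R a₁ a₂ 𝒬 𝒩 γ β m‖)) * this
  have hCS := Finset.sum_mul_sq_le_sq_mul_sq ℳ (fun m => Real.sqrt (w m) * t m)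
    (fun m => Real.sqrt (w m) * ‖innerSum R a₁ a₂ 𝒬 𝒩 γ β m‖)
  have h1 : ∑ m ∈ ℳ, (Real.sqrt (w m) * t m) ^ 2 = ∑ m ∈ ℳ, w m * t m ^ 2 :=
    Finset.sum_congr rfl fun m hm => by rw [mul_pow, Real.sq_sqrt (hw m hm)]
  have h2 : ∑ m ∈ ℳ, (Real.sqrt (w m) * ‖innerSum R a₁ a₂ 𝒬 𝒩 γ β m‖) ^ 2 =
      ∑ m ∈ ℳ, w m * ‖innerSum R a₁ a₂ 𝒬 𝒩 γ β m‖ ^ 2 :=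
    Finset.sum_congr rfl fun m hm => by rw [mul_pow, Real.sq_sqrt (hw m hm)]
  rw [h1, h2] at hCS
  refine le_trans ?_ hCS
  have h0 : 0 ≤ ∑ m ∈ ℳ, (Real.sqrt (w m) * t m) * (Real.sqrt (w m) * ‖innerSum R a₁ a₂ 𝒬 𝒩 γ β m‖) :=
    Finset.sum_nonneg fun m hm => by
      have := hw m hm; have := ht m hm; positivity
  exact pow_le_pow_left₀ (norm_nonneg _) htri 2

/-- **`|𝒟|² ≤ (∑_m w(m) t(m)²) (Re 𝒮₁ − 2 Re 𝒮₂ + Re 𝒮₃)`** — (5.10)–(5.11) of the source (there with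
`w = α(·)`, `t = τ^A`, `∑_m α(m)τ(m)^{2A} ≪ (log x)^{O(1)} M`), for real `γ`, `w, t ≥ 0` on `ℳ`,
`|α_m| ≤ t(m)w(m)`, and moduli `q ≥ 1`. [cite: Drappeau2017, §5.3 (5.10)–(5.11)] -/
theorem norm_dispSum_sq_le (R : ℝ) (a₁ a₂ : ℤ) (𝒬 ℳ 𝒩 : Finset ℕ) (γ w t : ℕ → ℝ)
    (α β : ℕ → ℂ) (h𝒬 : ∀ q ∈ 𝒬, 0 < q) (hw : ∀ m ∈ ℳ, 0 ≤ w m) (ht : ∀ m ∈ ℳ, 0 ≤ t m)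
    (hα : ∀ m ∈ ℳ, ‖α m‖ ≤ t m * w m) :
    ‖dispSum R a₁ a₂ 𝒬 ℳ 𝒩 γ α β‖ ^ 2 ≤
      (∑ m ∈ ℳ, w m * t m ^ 2) *
        ((dispS1 a₁ a₂ 𝒬 ℳ 𝒩 γ w β).re - 2 * (dispS2 R a₁ a₂ 𝒬 ℳ 𝒩 γ w β).re +
          (dispS3 R a₁ a₂ 𝒬 ℳ 𝒩 γ w β).re) := by
  rw [← sum_mul_norm_sq_innerSum_eq_re R a₁ a₂ 𝒬 ℳ 𝒩 γ w β h𝒬]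
  exact norm_dispSum_sq_le_mul_sum R a₁ a₂ 𝒬 ℳ 𝒩 γ w t α β hw ht hα

end Drappeau2017

end Literature.NumberTheory.Sieve

end
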